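import Summits.QuantumFields.YangMills.Theorems.BalabanUVNodesN15KingModelTorusFreeDeterminant
import Summits.QuantumFields.YangMills.Theorems.BalabanUVNodesN15KingModelTorusPlaneWaves
import Mathlib.Analysis.SpecialFunctions.Log.Deriv
import HarnessLib

/-!
# BalabanUVNodes ∕ N15 — THE KING-MODEL RUNG (PART Ε-x): THE MASS DERIVATIVE OF THE FREE ENERGY IS THE TRACE OF THE COVARIANCE — `∂_{m²} ln det(c(−Δ)+m²)_Ω = tr (c(−Δ)+m²)⁻¹
# = |Ω|·G(x,x)` on every torus (Jacobi's formula in King's plane waves), hence per site `∂_{m²}(|Ω|⁻¹ln det) = G(0,0) ∈ [1∕(m²+4c(d+1)), 1∕m²]` uniformly in the volume; monotonicity in `m²`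
# (Track A, DAG node N15 = NE2; FAN-OUT v1.1 §N15 s3 «KING-MODEL RUNG»; companion of parts Ε-e∕Ε-k; count-neutral)

HONEST FRAMING.  Count-neutral (cell `pub-ymgap`, seat `pub-ymgap-dag-n15-e` g40; `--supports stmt-QuantumFields-27366 --as helper` = K3⁸).
TEMPLATE LITERATURE: C. King, Commun. Math. Phys. **102** (1986) 649–677 [King1986], (3.89) p.668 (`ln N = −½ln det`), (4.4) p.670 (the symbol `lapSym`), (4.35) p.674 (plane waves);
the identity `∂_{m²}ln Z = −½Σ_x⟨φ(x)²⟩` is the free-field fluctuation–response relation (folklore).  Part Ε-k: `ln det(lapF K c m²) = Σ_q ln lapSym(q)`; part Ε-e: `(lapF K c m²)⁻¹(x,x) =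
|Ω|⁻¹Σ_q lapSym(q)⁻¹`.  THIS FILE: `hasDerivAt_lapSym`, `hasDerivAt_log_lapSym` (`∂_{m²}ln lapSym(q) = lapSym(q)⁻¹`), ★★ **`hasDerivAt_sum_log_lapSym`**, ★★★ **`hasDerivAt_log_det_lapF`**
(`∂_{m²}ln det(lapF K c m²) = Σ_q lapSym(q)⁻¹`), ★★★ **`hasDerivAt_log_det_lapF_eq_trace`** (`= tr (lapF K c m²)⁻¹ = Σ_x G(x,x)`), ★★ **`sum_inv_lapSym_eq_card_mul_diag`** (`Σ_q lapSym(q)⁻¹ =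
|Ω|·G(x,x)`, every `x`), ★★ **`hasDerivAt_log_det_lapF_div_card`** (per site the derivative IS the coincident-point covariance `G(x,x)`), `deriv_log_det_lapF_div_card_bounds` (`∈ [1∕(m²+4c(d+1)),
1∕m²]`, uniform in the volume — part Ε-e), ★ `log_det_lapF_mono` (monotone in `m²`).

PRIOR TREE ART (used, not restated): part Ε-k (`log_det_lapF`, `det_lapF_pos`), part Ε-e (`lapF_inv_diag_eq`, `lapF_inv_diag_le_inv_mass`, `inv_le_lapF_inv_diag`), `King1986` (`lapSym`, `lapSym_ge`),
Mathlib (`HasDerivAt.log`, `HasDerivAt.fun_sum`, `HasDerivAt.congr_of_eventuallyEq`).  NOT Bałaban's covariant objects; NOT a node discharge (N15 is booked through n15-a's knit,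
untouched); nothing continuum-YM ∕ `ℝ⁴` ∕ OS ∕ Clay.  0 `sorry`, 0 `def`.

HONEST SCOPE.  King's free massive operator on any torus `Π_μℤ∕K_μ` (dimension written `d+1`), `c ≥ 0`, `m² > 0`; one-variable calculus in `m²`.  Locators: [King1986] (3.89) p.668,
(4.4) p.670, (4.35) p.674.
-/

noncomputable section

open scoped BigOperators Topology
open Finset Filter

namespace Summit.QuantumFields.YangMills.BalabanUVNodes.N15KingModelRung.TorusSpectral

open Literature.MathematicalPhysics.QuantumFieldTheory.Balaban1983to89.B5Prop11Plancherel (Tor sOf)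
open Literature.MathematicalPhysics.QuantumFieldTheory.King1986.Torus

variable {d : ℕ} (K : Fin (d + 1) → ℕ) [hK : ∀ μ, NeZero (K μ)] {c : ℝ}

omit hK in
/-- `∂_{m²} lapSym(q) = 1`. [cite: King1986, (4.4) p.670] -/
theorem hasDerivAt_lapSym (c m2 : ℝ) (q : Tor K) : HasDerivAt (fun m => lapSym K c m q) 1 m2 := by
  unfold lapSym
  exact (hasDerivAt_id m2).add_const _

omit hK in
/-- `∂_{m²} ln lapSym(q) = lapSym(q)⁻¹` (`c ≥ 0`, `m² > 0`). [cite: King1986, (4.4) p.670] -/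
theorem hasDerivAt_log_lapSym (hc : 0 ≤ c) {m2 : ℝ} (hm : 0 < m2) (q : Tor K) :
    HasDerivAt (fun m => Real.log (lapSym K c m q)) (lapSym K c m2 q)⁻¹ m2 := by
  have hpos : 0 < lapSym K c m2 q := lt_of_lt_of_le hm (lapSym_ge K c m2 hc q)
  have h := (hasDerivAt_lapSym K c m2 q).log hpos.ne'
  simpa using h

/-- ★★ `∂_{m²} Σ_q ln lapSym(q) = Σ_q lapSym(q)⁻¹`. [cite: King1986, (4.4) p.670, (4.35) p.674] -/
theorem hasDerivAt_sum_log_lapSym (hc : 0 ≤ c) {m2 : ℝ} (hm : 0 < m2) :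
    HasDerivAt (fun m => ∑ q : Tor K, Real.log (lapSym K c m q)) (∑ q : Tor K, (lapSym K c m2 q)⁻¹) m2 :=
  HasDerivAt.fun_sum fun q _ => hasDerivAt_log_lapSym K hc hm q

/-- ★★★ **`∂_{m²} ln det(c(−Δ)+m²)_Ω = Σ_{q∈Ω̂} lapSym(q)⁻¹`** (part Ε-k's closed form differentiated; `c ≥ 0`, `m² > 0`, every torus). [cite: King1986, (3.89) p.668, (4.4) p.670] -/
theorem hasDerivAt_log_det_lapF (hc : 0 ≤ c) {m2 : ℝ} (hm : 0 < m2) :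
    HasDerivAt (fun m => Real.log (lapF K c m).det) (∑ q : Tor K, (lapSym K c m2 q)⁻¹) m2 := by
  refine (hasDerivAt_sum_log_lapSym K hc hm).congr_of_eventuallyEq ?_
  filter_upwards [Ioi_mem_nhds hm] with m hm'
  exact log_det_lapF K hc hm'

/-- ★★ **`Σ_{q∈Ω̂} lapSym(q)⁻¹ = |Ω|·G(x,x)`** for every site `x` (part Ε-e's diagonal formula). [cite: King1986, (4.35) p.674] -/
theorem sum_inv_lapSym_eq_card_mul_diag (hc : 0 ≤ c) {m2 : ℝ} (hm : 0 < m2) (x : Tor K) :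
    ∑ q : Tor K, (lapSym K c m2 q)⁻¹ = Fintype.card (Tor K) * (lapF K c m2)⁻¹ x x := by
  have hcard : (Fintype.card (Tor K) : ℝ) ≠ 0 := by exact_mod_cast Fintype.card_ne_zero
  rw [lapF_inv_diag_eq K hc hm x, ← mul_assoc, mul_inv_cancel₀ hcard, one_mul]

/-- ★★★ **JACOBI's FORMULA FOR THE FREE FIELD: `∂_{m²} ln det(c(−Δ)+m²)_Ω = tr (c(−Δ)+m²)⁻¹_Ω`** (the derivative of the free energy in the mass is the trace of the covariance).
[cite: King1986, (3.89) p.668, (4.35) p.674] -/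
theorem hasDerivAt_log_det_lapF_eq_trace (hc : 0 ≤ c) {m2 : ℝ} (hm : 0 < m2) :
    HasDerivAt (fun m => Real.log (lapF K c m).det) (Matrix.trace (lapF K c m2)⁻¹) m2 := by
  have h := hasDerivAt_log_det_lapF K hc hm
  have htr : Matrix.trace (lapF K c m2)⁻¹ = ∑ q : Tor K, (lapSym K c m2 q)⁻¹ := by
    rw [Matrix.trace]
    have hcard : (Fintype.card (Tor K) : ℝ) ≠ 0 := by exact_mod_cast Fintype.card_ne_zero
    simp_rw [Matrix.diag_apply, lapF_inv_diag_eq K hc hm, Finset.sum_const, Finset.card_univ, nsmul_eq_mul, ← mul_assoc, mul_inv_cancel₀ hcard, one_mul]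
  rw [htr]
  exact h

/-- ★★ **PER SITE THE MASS DERIVATIVE IS THE COINCIDENT-POINT COVARIANCE**: `∂_{m²}(|Ω|⁻¹ln det(c(−Δ)+m²)_Ω) = G(x,x)` (any `x`; translation invariance). [cite: King1986, (3.89) p.668, (4.35) p.674] -/
theorem hasDerivAt_log_det_lapF_div_card (hc : 0 ≤ c) {m2 : ℝ} (hm : 0 < m2) (x : Tor K) :
    HasDerivAt (fun m => (Fintype.card (Tor K) : ℝ)⁻¹ * Real.log (lapF K c m).det) ((lapF K c m2)⁻¹ x x) m2 := by
  have hcard : (Fintype.card (Tor K) : ℝ) ≠ 0 := by exact_mod_cast Fintype.card_ne_zero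
  have h := (hasDerivAt_log_det_lapF K hc hm).const_mul ((Fintype.card (Tor K) : ℝ)⁻¹)
  rw [sum_inv_lapSym_eq_card_mul_diag K hc hm x, ← mul_assoc, inv_mul_cancel₀ hcard, one_mul] at h
  exact h

/-- the per-site derivative lies in `[1∕(m²+4c(d+1)), 1∕m²]`, uniformly in the volume (part Ε-e). [cite: King1986, (4.4) p.670] -/
theorem deriv_log_det_lapF_div_card_bounds (hc : 0 ≤ c) {m2 : ℝ} (hm : 0 < m2) (x : Tor K) :
    (m2 + 4 * c * (d + 1))⁻¹ ≤ deriv (fun m => (Fintype.card (Tor K) : ℝ)⁻¹ * Real.log (lapF K c m).det) m2 ∧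
      deriv (fun m => (Fintype.card (Tor K) : ℝ)⁻¹ * Real.log (lapF K c m).det) m2 ≤ m2⁻¹ := by
  rw [(hasDerivAt_log_det_lapF_div_card K hc hm x).deriv]
  exact ⟨inv_le_lapF_inv_diag K hc hm x, lapF_inv_diag_le_inv_mass K hc hm x⟩

/-- ★ the free energy is monotone in the mass: `m² ≤ m′² ⇒ ln det(lapF K c m²) ≤ ln det(lapF K c m′²)`. [cite: King1986, (4.4) p.670] -/
theorem log_det_lapF_mono (hc : 0 ≤ c) {m2 m2' : ℝ} (hm : 0 < m2) (hle : m2 ≤ m2') :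
    Real.log (lapF K c m2).det ≤ Real.log (lapF K c m2').det := by
  have hm' : 0 < m2' := lt_of_lt_of_le hm hle
  rw [log_det_lapF K hc hm, log_det_lapF K hc hm']
  refine Finset.sum_le_sum fun q _ => Real.log_le_log (lt_of_lt_of_le hm (lapSym_ge K c m2 hc q)) ?_
  unfold lapSym
  linarith

end Summit.QuantumFields.YangMills.BalabanUVNodes.N15KingModelRung.TorusSpectral

end
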